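import Summits.CriticalPhenomena.CardyFormulaZ2.Theses.CardyComplexCone
import Summits.CriticalPhenomena.CardyFormulaZ2.Theorems.CardyComplexConeDefs
import Summits.CriticalPhenomena.CardyFormulaZ2.Theorems.CardyComplexConeEdgePrecompactIpAsymptotic
import Summits.CriticalPhenomena.CardyFormulaZ2.Theorems.CardyComplexConeEdgePrecompactHalfArmLeStrip
import Summits.CriticalPhenomena.CardyFormulaZ2.Theorems.CardyComplexConeEdgePrecompactIpExact
import Summits.CriticalPhenomena.CardyFormulaZ2.Theorems.CardyComplexConeEdgePrecompactTranslationCovariance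
import Summits.CriticalPhenomena.CardyFormulaZ2.Theorems.CardyComplexConeEdgePrecompactShiftStabilityReduction
import Summits.CriticalPhenomena.CardyFormulaZ2.Theorems.CardyComplexConeEdgePrecompactVertexRelation
import Summits.CriticalPhenomena.CardyFormulaZ2.Theorems.CardyComplexConeEdgePrecompactHullStabilityReduction
import Summits.CriticalPhenomena.CardyFormulaZ2.Theorems.CardyComplexConeEdgePrecompactResponseStabilityUniform
import Literature.Probability.LatticeModels.DartPhase
import Summits.CriticalPhenomena.CardyFormulaZ2.Theorems.CardyComplexConeEdgePrecompactEnvelopeFromLocal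

/-!
# Line `qkz-strip-boundary-arm` for crux `CardyComplexCone.EdgePrecompact` (stmt-CriticalPhenomena-11387)

Skeleton (crux-plan, planner-cruxplan-stmt-CriticalPhenomena-11387-qkz-strip-boundary-a-0, 2026-08-16) of
crux idea `Cruxes/EdgePrecompact/Ideas/qkz-strip-boundary-arm.md` (crux-ideate r1, ideator 3; triage r1-1/2/3:
pass ×3), with the triage sharpenings built in: (a) the integrable calibration is CITED AND TYPED from
Ikhlef–Ponsaing, *Finite-size left-passage probability in percolation*, J. Stat. Phys. 149 (2012) 10–36
(arXiv:1202.5476), Props. 4.5, 4.7, 4.9 — not re-conjectured from MNdGB 2004; (b) the strip is the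
DIAGONAL strip `0 ≤ x₀ + x₁ ≤ L` of `ℤ²` (a row of Temperley–Lieb tiles = a staircase of lattice edges;
the walls of the medial strip run along lattice diagonals); (c) only the UPPER bound is consumed; (d) the
calibration alone does not close the crux — the line is the whole programme of the three ideator-3 cards
(qkz = (P), stream-function = (T), shift-coupling = clause (ii)), and the skeleton names each part.

THE LINE. Write `E_δ(v,f) = cornerObs (Λ δ) δ v f` for the crux's spin-1/3 corner observable (verbatim
the crux integrand, `cornerObs`). The crux asks, on compacts `K ⊂ D`: (i) `‖E_δ‖ ≤ C δ^{1/3}`, (ii)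
same-class equicontinuity at scale `δ^{1/3}`.
* (P) — THE LEVER, integrability of bond-`ℤ²` at `q = e^{2πi/3}`. In the diagonal strip
  `S_L = {0 ≤ x₀+x₁ ≤ L}` with the wall `{x₀+x₁ = 0}` wired, `L = 2m+1` odd, the `P_{1/2}`-probability
  that a site `b` next to the free face (`b₀+b₁ = L−1`) is joined to the wired wall inside the strip is
  EXACTLY Ikhlef–Ponsaing's first-site passage probability of the infinite hull,
  `P_b(L) = A_V(L) A_V(L+2) / N_8(L+1)²` (`A_V` = vertically symmetric ASMs, `N_8` = CSSCPPs) — this is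
  `stub_ipExact` (dictionary: hull through the first cut-site ⇔ the dual site next to the wired wall is
  dual-joined to the free face ⇔, by self-duality + the anti-diagonal reflection of the strip, `b` is
  joined to the wired wall; CHECKED by Monte-Carlo in this seat, 4–6·10⁴ samples each: L = 3, 5, 7 give
  0.7508(18), 0.6436(24), 0.5825(20) against 3/4, 78/121 = 0.6446, 247/425 = 0.5812); `stub_ipAsymptotic` is the Γ-function asymptotics
  `P_b(L) ≤ C L^{-1/3}` of that product (IP12 Prop. 4.9, upper half; provable now); `stub_halfArm_le_strip`
  is the lattice-symmetry glue turning it into the bound `halfArm n ≤ C' n^{-1/3}` for the DIAGONAL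
  HALF-PLANE ONE-ARM probability to depth `n` (`halfArm`, `halfArm_bound` — proved here from the three).
* (T) — `stub_twistedComparison` (HARDEST, the crux's signed `δ^{1/12}` cancellation in dimensionless
  form, card stream-function-boundary-calibration): at lattice depth `R` in any admissible discretisation of
  a Jordan Dobrushin domain, `‖cornerObs‖ ≤ C · halfArm R`. With (P) this gives the UNIFORM INNER ENVELOPE
  `‖cornerObs‖ ≤ C R^{-1/3}` (`UniformInnerEnvelope`, theorem `uniformInnerEnvelope`), from which clause
  (i) follows by compactness (`boundClause`, proved: depth `≥ dist(K,∂D)/δ → ∞` — exactly where the crux's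
  interiority of `K` is used, cf. the disprover's `edgePrecompact_false_without_compactness_of_familyExists`).
* (ii) — `stub_translationCovariance` (exact, provable now: a same-class pair of corners is a lattice
  translate, and translating the corner = translating the Dobrushin data) + `stub_shiftStability` (the
  corner observable is stable at precision `o(δ^{1/3})` under rigid shifts of the data by `o(1)`, GIVEN the
  uniform envelope: same-`ω` coupling of the two explorations, ordered-excursion merge event — the triage
  repair of the card's topological lemma —, boundary three-arm / marked-point re-rooting estimates, and a
  decoupling of the non-merge event from the inner twisted amplitude); clause (ii) is assembled from the two
  in `equicontClause` (proved).
* `EdgePrecompact_of : EdgePrecompact` — the kernel-checked composition (no `sorry` of its own).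

Disproof.lean (cdisprove v1–v4 on the item): its text is not readable from a crux-plan seat (gate evidence
store not mounted; not published under `Cruxes/EdgePrecompact/`); used through its evidence abstracts. The
stub set honours `_false_without_compactness` (all envelopes are at lattice depth `R ≥ 1`; `δ^{1/3}` appears
only after `R ≥ dist(K, Dᶜ)/δ`), the load-bearing `Ω`- and mesh-equalities (used verbatim in `boundClause` /
`equicontClause`), the envelope `‖E‖ ≤ 1` (consistent with (T) at `R = 1`), and F8 "(ii) ⇔ translation
stability" (= `stub_translationCovariance` + `stub_shiftStability`). No `Theorems/EdgePrecompact/Negative/*`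
lemma has landed; `ledger negatives` (7 CriticalPhenomena items) instantiates no stub.
## Lead's status (prover-line-stmt-CriticalPhenomena-11387-0, reshape r1, 2026-08-16)

LANDED (all `--supports stmt-CriticalPhenomena-11387`, imported above, same namespace):
`CardyComplexConeDefs` (vocabulary, p73249), `stub_ipAsymptotic` (p74392, C = 2: `ipRatio (m+1) = ipRatio m ·
(3m+5)(6m+7)(4m+3)/((3m+4)(6m+5)(4m+7))` and `ipRatio m³ (m+1)` non-increasing), `stub_halfArm_le_strip` (p75102),
`medialExploration_shiftData` (p75892, sub-goal: exploring translated data in the translated configuration gives the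
translated path), `stub_translationCovariance` (p76471), the bridge `stub_ipExact_of_IkhlefPonsaing` (p75868) from the
relocated Literature named fact `Literature.Probability.Percolation.IkhlefPonsaingFirstPassage` (p75867; IP12 Prop. 4.7;
the identity is certified EXACTLY for m ≤ 5 by rational transfer matrices, item evidence), and the reduction
`shiftStability_of : X1 → X2 → ShiftStability` (p76884).
RESHAPE r1: (a) `stub_shiftStability : UniformInnerEnvelope → ShiftStability` is EXPIRED — the unconditional envelope
bounds each observable by `C δ^{1/3}` but never a difference by `ε δ^{1/3}`; what clause (ii) needs is exactly
X1 = `stub_localInnerEnvelopeUI` (conditional inner envelope in uniform-integrability tail form: restricted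
expectations over exterior-measurable events of small probability are `≤ ε₁ (δ/ρ)^{1/3}`) and X2 =
`stub_shiftCouplingLocality` (phase-free same-`ω` coupling: the difference of the dart observables of `Λδ` and of its
lattice translate is carried by an exterior-measurable event of probability `≤ ε`), glued by the landed
`shiftStability_of`; (b) `stub_twistedComparison` is split into T1 = `stub_vertexRelation` (the half-CR vertex relation
for `cornerObs` at interior medial vertices of arbitrary admissible data, DCS Prop. 8.6 / DC 2012 Prop. 4 — the edge-flip
involution at `p = 1/2`; provable now; first identity of the stream-function mechanism) and T2 =
`stub_twistedComparison_of : T1-statement → (T)` (the open core proper: flux calibration + modulus-only inner–outer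
factorisation), with `twistedComparison := stub_twistedComparison_of stub_vertexRelation`.
OPEN registered stubs after r1: `stub_ipExact` (closed modulo the named fact via the bridge), `stub_vertexRelation` (T1),
`stub_twistedComparison_of` (T2, open core), `stub_localInnerEnvelopeUI` (X1, conditional twin of the core),
`stub_shiftCouplingLocality` (X2). `EdgePrecompact_of` still concludes the crux by name with no `sorry` of its own.
## Lead's status, reshape r2/r3 (2026-08-16, ~08:30Z)

r2: `stub_vertexRelation` restricted to Jordan data (`E.Ω = D.carrier`): the r1 ∀-admissible form is FALSE (exact enumeration on a
holed `Ω_δ`, evidence `vertexRelation_hole_cex.md`; also refutes the sibling item `CardySublatticeCoherence.HalfCRVertexRelation` as stated).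
r3: (T1) `stub_vertexRelation` LANDED (p91094; parts p87666 chainWinding_eq_zero, p90361 spliceLoop_turning_eq, p89255
vertexRelation_onceTwice, p90561 vertexRelation_pairSum; χ = +i) — the q = 1 half-CR vertex relation for the corner observable on Jordan
data is a theorem of the tree. (X2) `stub_shiftCouplingLocality` is DERIVED: landed chain `shiftCouplingLocality_of_hullStability` (p81131)
∘ `hullStability_of_responseStability` (p84484; with passageSync p82619, passageAgree_of_response p83367) ∘
`responseStability_of_uniformForwardResponseStability` (p90428; with responseStability_of_forwardResponseStability p87107,
responseLocalisation p88671, collarAgreement p89352, forwardResponseStability_of_uniformForwardResponseStability p90372) applied to the one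
remaining phase-free probabilistic input `stub_uniformForwardResponseStability` (UFRS: uniform single-datum forward response stability — collar
half-plane three-arm summation + marked-point re-rooting; the union bound over η-boxes of ∂D needs #boxes = o(η^{-(1+α)}), fine for rectifiable
boundaries, a screening lemma not in print for rough Jordan curves).
OPEN registered stubs after r3 (4): `stub_ipExact` (closed modulo the Literature fact `IkhlefPonsaingFirstPassage`), `stub_twistedComparison_of`
(T2 — THE OPEN CORE), `stub_localInnerEnvelopeUI` (X1 — its conditional twin), `stub_uniformForwardResponseStability` (UFRS).
## Lead c2's status, reshape r4 (prover-line-stmt-CriticalPhenomena-11387-c2-0, 2026-08-16 ~13:30Z)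

r4: X1 IS THE CORE. The landed glue `uniformInnerEnvelope_of_localInnerEnvelopeUI`
(`Theorems/CardyComplexConeEdgePrecompactEnvelopeFromLocal.lean`, p115250; companion `localInnerEnvelopeUI_of_linearLocalEnvelope`,
`…EnvelopeLinear.lean`, p115318: the LINEAR local envelope implies X1) proves that the registered, drefute-survived stub
`stub_localInnerEnvelopeUI` (X1, uniform-integrability tail form) ALONE implies the line's junction `UniformInnerEnvelope`, by THINNING:
for admissible `E` the domain is bounded, so there are `k` lattice edges far outside `Ω` (`exists_farEdges`); "all `k` open" is measurable off
every ball inside `Ω`, has probability exactly `2^{-k} ≤ ε'(1)` (`real_allOpen`) and is independent of the dart phase sum, which reads only the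
edges of `Ω_δ` (`setIntegral_allOpen_eq`, from `medialExploration_inter_eq` + `bondPercolation_indep_edgeSigma`); so X1 gives
`2^{-k}‖cornerObs‖ ≤ (δ/ρ)^{1/3}` on every ball `closedBall (δv) ρ ⊆ Ω`, and `ρ = Rδ/2` at depth `R`. Hence clause (i) no longer passes
through (T2) nor through the (P) calibration: `stub_twistedComparison_of` (T2) and `stub_ipExact` (P1, conditional on the Literature named
fact `IkhlefPonsaingFirstPassage`, whose qKZ proof is being landed under `Literature/Probability/Percolation/DiagonalStrip*.lean`) LEAVE THE
COMPOSITION — they stay in the tree as landed supports / side statements (T1 `stub_vertexRelation` p91094, P2 `stub_ipAsymptotic` p74392,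
P3 `stub_halfArm_le_strip` p75102, bridge `stub_ipExact_of_IkhlefPonsaing` p75868; the (P) chain is kept below as the CONDITIONAL side result
`halfArm_bound_of_IkhlefPonsaing`, the intended boundary calibration for a future PROOF of X1) and are no longer obligations.
OPEN registered stubs after r4 (2, statements byte-identical to r3): `stub_localInnerEnvelopeUI` (X1 — THE OPEN CORE: the crux's δ^{1/12}
winding-phase cancellation in local, dimensionless, conditional form; held by the lead) and `stub_uniformForwardResponseStability` (UFRS —
phase-free; road-map items 1–3, 5 landed: `collarAgreement`, `responseLocalisation`, `ufrs_failureStructure`, `ufrs_strandArms`,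
`ufrs_discrepancyEdges`, `ufrs_of_armDomination`; lead c2's worker W1 added `ufrs_of_screenedArmDomination` p115270 (summation from arm domination +
decay of the UNION over collar points, no box count), `strandSynthesis`/`merge_or_through`/`whiskerContact`/`ufrs_mergeCollar` p115282, `ufrs_faceExit(AtMarkedEdge)`
p115292, `run_whisker_trichotomy` p115306, `ufrs_initialStrands` (to follow); W1's verdict: `stub-blocked` — the probabilistic input "screened collar three-arm
estimate" for a general (rough) Jordan `∂D` is not in print (flat case only: `Z2HalfPlane.real_threeArm_le`), and the deterministic (H₁) remains to be assembled).
Numerics for X1 (lead c2, evidence `X1ConditionalEnvelopeMC.md` #83): under 12 adversarial exterior conditionings, R = ρ/δ = 4…48, max_ξ |E[F|ξ]|·R^{1/3}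
is flat at 0.70 ± 0.04 and the cancellation factor |E|/P(pass) decays at the CFT rate R^{-1/12} — the linear local envelope (⇒ X1 ⇒ (i)) is numerically sound.
## Lead c4's status (prover-line-stmt-CriticalPhenomena-11387-c4-0, cycle 4, 2026-08-16/17): skeleton UNCHANGED (r4); hardness and the UFRS programme made formal

No reshape: the composition and the two registered stubs X1 `stub_localInnerEnvelopeUI`, UFRS `stub_uniformForwardResponseStability`
are byte-identical to r4 (no reshape can remove either: disprover F8 + the thinning lemma). Cycle 4 landed 41 `--supports` modules:
(1) the NECESSITY CERTIFICATE for X1 — N5 `halfBoxArm_le_threeSided_conn`, N6 `threeSided_wallObs`, `threeSided_vertexRelations` + sum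
bound + projection lemmas, core `threeSided_fluxCoreEstimate`, conclusion `halfPlaneArm_cubeRoot_of_uniformInnerEnvelope`, and the one-name
forms `halfPlaneArm_cubeRoot_of_localInnerEnvelopeUI` / `halfPlaneArm_logExponent_le_of_localInnerEnvelopeUI`: X1 ⇒ `UniformInnerEnvelope` ⇒
`P_{1/2}(half-box one-arm at scale n) ≤ C n^{-1/3}` ⇒ eventually `log P / log n ≤ -1/3 + ε` for bond-ℤ² — the upper half of the OPEN crux
`HalfPlaneOneArmThird` (stmt-5662, same event); (2) X1 VERBATIM AT AN RSW EXPONENT, unconditional (`linearLocalEnvelope_rsw`,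
`localInnerEnvelopeUI_rsw`): the open content of X1 is exactly the value `1/3` of the exponent; (3) the composition PER DOMAIN
(`EdgePrecompact_at_of_X1_of_ufrsAt : ∀ D, X1 → UFRS at D → EdgePrecompact at D`, `Iff.rfl`-certified, and
`EdgePrecompact_rect_of_X1_of_ufrsRect : X1 → ufrs_rect → EdgePrecompact on axis-parallel rectangles`); (4) the UFRS programme: road map
CORRECTED (two-scale certificate; rigidity), event vocabulary `…UFRSEvents`, PROVED glue `ufrs_of_pieces`, M1 `ufrs_strands_zdDomArms` LANDED,
(H₁') `ufrs_armDomination2_of_residuals` (modulo 4 registered planar residuals), M3 `ufrs_screenedCollarDecay_rect_of_boundaryStrandDecay` and M4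
`ufrs_markedPointDecay_rect_of_bridges` (modulo 3 registered boundary-arm bridges porting `Z2HalfPlane` two/three-arm bounds to strand families).
OPEN after cycle 4: X1 (research-open, certified ≥ a sharp ℤ² boundary arm exponent); UFRS = for rectangles the 4 residuals + 3 bridges
(registered, each with landed callers), for general Jordan D additionally the screening lemma `ufrs_screenedCollarDecay` (not in print).
-/

namespace Summit.CriticalPhenomena.CardyFormulaZ2.Cruxes.EdgePrecompact.QkzStripBoundaryArm

open MeasureTheory Filter Set Metric ProbabilityTheory
open scoped Topology BigOperators Pointwise
open Literature.Probability.LatticeModels Literature.Probability.Percolation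
open Literature.Probability.RandomPlanarGeometry (DobrushinDomain)
open Summit.CriticalPhenomena.CardyFormulaZ2.Theses.CardyComplexCone

set_option linter.unusedVariables false

noncomputable section

/-! ## Vocabulary

All objects (`cornerObs`, `diagStrip`, `diagHalfPlane`, `wallConn`, `halfArmEvent`, `halfArm`, `vsasm`,
`csscpp`, `ipRatio`, `shiftData`, `UniformInnerEnvelope`, `ShiftStability`) and the glue identities
`meshPoint_neg`, `image_add_right_eq_vadd`, `shiftData_shiftData_neg` live in the landed definitions module
`Summits/CriticalPhenomena/CardyFormulaZ2/Theorems/CardyComplexConeDefs.lean` (p73249, same namespace), which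
this skeleton and every stub helper file import. -/

/-! ## The stubs -/

/-- **(P2) `stub_ipAsymptotic`, (P3) `stub_halfArm_le_strip`, (ii-a) `stub_translationCovariance`** — LANDED
(modules imported above; the names resolve to the landed theorems). (P1) `stub_ipExact` is landed CONDITIONALLY as the bridge
`stub_ipExact_of_IkhlefPonsaing` from the Literature named fact; since r4 none of (P1)–(P3) is an obligation of the composition. -/
example : (∃ C : ℝ, ∀ m : ℕ, ipRatio m ≤ C * (2 * (m : ℝ) + 1) ^ (-(1:ℝ) / 3)) ∧
    (∀ (m : ℕ) (b : Site 2), b 0 + b 1 = 2 * m → ∀ n : ℕ, 2 * m + 1 ≤ n →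
      halfArm n ≤ 2 * (bondPercolation (zdGraph 2) half).real (wallConn (2 * m + 1) b)) ∧
    (∀ (E : DiscreteDobrushin) (δ : ℝ) (w v f : Site 2), IsCorner v f →
      cornerObs (shiftData E w) δ (v + w) (f + w) = cornerObs E δ v f) :=
  ⟨stub_ipAsymptotic, stub_halfArm_le_strip, stub_translationCovariance⟩

/-- (P1) in its landed conditional form (bridge from the Literature named fact, p75868). -/
example : Literature.Probability.Percolation.IkhlefPonsaingFirstPassage → ∀ (m : ℕ) (b : Site 2), b 0 + b 1 = 2 * m →
    (bondPercolation (zdGraph 2) half).real (wallConn (2 * m + 1) b) = ipRatio m :=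
  stub_ipExact_of_IkhlefPonsaing

/-- **(T1) `stub_vertexRelation` — the half-CR VERTEX RELATION for the corner observable on Jordan data: LANDED (p91094, χ = +i; the
name resolves to the landed theorem of `…EdgePrecompactVertexRelation`).** Since r4 it is a side result (first identity of the
stream-function mechanism intended for a proof of X1), not an obligation. The r1–r3 stub (T2) `stub_twistedComparison_of : T1 → (T)`,
(T) = "`‖cornerObs E E.δ v f‖ ≤ C · halfArm R` at lattice depth `R` in every Jordan Dobrushin domain", is likewise no longer registered:
its only use was clause (i), which X1 now supplies (`uniformInnerEnvelope` below). -/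
example := stub_vertexRelation

/-- **(X1) `stub_localInnerEnvelopeUI` — THE OPEN CORE since r4: LOCAL INNER ENVELOPE, uniform-integrability tail form (XL;
reshape r1; by the thinning lemma `innerEnvelope_of_localInnerEnvelopeUI` it contains the unconditional envelope
`‖cornerObs‖ ≤ C (δ/ρ)^{1/3}`, i.e. clause (i), and it is the (X1) input of clause (ii)).** For every `ε₁ > 0` there is
`ε' > 0` such that for every admissible datum `E` (any bounded domain, any arcs), corner `(v,f)`, radius `ρ ≥ E.δ`
with `closedBall (δv) ρ ⊆ E.Ω` and every event `A` measurable with respect to the configuration OFF the ball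
`B(δv, ρ)` with `P(A) ≤ ε'`: `‖E[F_{v,f} ; A]‖ ≤ ε₁ (E.δ/ρ)^{1/3}` (`F` = the spin-1/3 dart phase sum, `cornerObs = ∫ F`
by `cornerObs_eq_integral_dartPhaseSum`). Why plausibly true: locality + the scale-free envelope for multi-arc exterior
patterns (DCS Conj. 8.7 normalisation at `q = 1` in local form); rare many-arm exterior patterns carry conditional
amplitudes `≫ (δ/ρ)^{1/3}` but small mass. Why it might fail: the sharp `1/3` itself. Strictly weaker than the sibling
line's affine form `Sig.stub_localInnerEnvelope`. -/
theorem stub_localInnerEnvelopeUI : ∀ ε₁ > (0:ℝ), ∃ ε' > (0:ℝ), ∀ (E : DiscreteDobrushin), E.IsZdAdmissible → ∀ v f : Site 2, IsCorner v f → ∀ ρ : ℝ, E.δ ≤ ρ → closedBall (meshPoint E.δ v) ρ ⊆ E.Ω → ∀ A : Set (BondConfig (Site 2)), MeasurableSet[MeasurableSpace.comap (fun ω : BondConfig (Site 2) => ω \ {e | medialPoint E.δ e ∈ ball (meshPoint E.δ v) ρ}) (inferInstance : MeasurableSpace (BondConfig (Site 2)))] A → (bondPercolation (zdGraph 2) half).real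 A ≤ ε' → ‖∫ ω in A, dartPhaseSum (medialExploration E ω) E.δ (1 / 3) (v, f) ∂(bondPercolation (zdGraph 2) half)‖ ≤ ε₁ * (E.δ / ρ) ^ ((1:ℝ) / 3) := by
  sorry

/-- **(ii-c, X2 residual) `stub_uniformForwardResponseStability` — UNIFORM FORWARD RESPONSE STABILITY (L–XL; reshape r3; the one
remaining phase-free probabilistic input of shift-coupling locality).** For a Jordan Dobrushin domain `D`, a compact `K` with
`cthickening (2ρ) K ⊆ D` and `ε > 0` there are `η, δ₀ > 0` such that for EVERY admissible discretisation `E` of `D` with mesh `< δ₀`, every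
`v` with `δv ∈ K` and lattice shift `w` with `‖δw‖ < η`: with `P_{1/2}`-probability `≥ 1 − ε`, the cut orbits (explorations) of `E` and of its
translate `shiftData E w` in the SAME configuration respond alike at the ball `B(δv, ρ)` — started from the two start corners, or from a common dart
exiting the ball, if one orbit re-enters the ball after a stretch of exterior inner-face darts then so does the other, through the same dart and
with the same accumulated turning. Why plausibly true: the two data differ only in an `η`-collar of `∂D`; a discrepancy localises (landed
`responseLocalisation`, `collarAgreement`) at a collar box that is pivotal for the hull down to distance `≥ ρ` — a half-plane three-arm event of
probability `(η/ρ)^{1+α}` — or at the marked points (two-arm, `η/ρ`); RSW merging for macroscopic parts. Why it might fail / what is missing: the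
union bound over the `η`-boxes covering `∂D` needs `#boxes · (η/ρ)^{1+α} → 0`, i.e. box-counting control of `∂D` (rectifiable: fine); for rough
Jordan curves a screening argument not in print; the bond-ℤ² half-plane arm bounds are to be ported (`Z2HalfPlane.real_threeArm_le`-type targets).
X2 follows by the landed chain `shiftCouplingLocality_of_hullStability ∘ hullStability_of_responseStability ∘
responseStability_of_uniformForwardResponseStability` (see `shiftStability` below). -/
theorem stub_uniformForwardResponseStability : ∀ (D : DobrushinDomain) (K : Set ℂ), IsCompact K → K ⊆ D.carrier → ∀ ρ > (0:ℝ), cthickening (2 * ρ) K ⊆ D.carrier → ∀ ε > (0:ℝ), ∃ η > (0:ℝ), ∃ δ₀ > (0:ℝ), ∀ E : DiscreteDobrushin, E.Ω = D.carrier → E.IsZdAdmissible → E.δ < δ₀ → ∀ v w : Site 2, meshPoint E.δ v ∈ K → ‖meshPoint E.δ w‖ < η → (bondPercolation (zdGraph 2) half).real {ω : BondConfig (Site 2) | ¬ ∀ a a' : Site 2 × Fin 4, ((E.IsStartCorner a ∧ (shiftData E w).IsStartCorner a') ∨ (a = a' ∧ medialPoint E.δ (cSrc a) ∈ ball (meshPoint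 E.δ v) ρ ∧ medialPoint E.δ (cTgt a) ∉ ball (meshPoint E.δ v) ρ)) → ∀ n : ℕ, (∀ i < n, medialPoint E.δ (cTgt (cornerOrbit (E.bcBondConfig ω) a i)) ∉ ball (meshPoint E.δ v) ρ ∧ E.IsInnerFace (cFace (cornerOrbit (E.bcBondConfig ω) a (i + 1)))) → medialPoint E.δ (cTgt (cornerOrbit (E.bcBondConfig ω) a n)) ∈ ball (meshPoint E.δ v) ρ → ∃ n' : ℕ, (∀ i < n', medialPoint E.δ (cTgt (cornerOrbit ((shiftData E w).bcBondConfig ω) a' i)) ∉ ball (meshPoint E.δ v) ρ ∧ (shiftData E w).IsInnerFace (cFace (cornerOrbit ((shiftData E w).bcBondConfig ω) a' (i + 1)))) ∧ cornerOrbit ((shiftData E w).bcBondConfig ω) a' n' = cornerOrbit (E.bcBondConfig ω) a n ∧ ∑ i ∈ Finset.range n', turnOf ((shiftData E w).bcBondConfig ω) (cornerOrbit ((shiftData E w).bcBondConfig ω) a' i) = ∑ i ∈ Finset.range n, turnOf (E.bcBondConfig ω) (cornerOrbit (E.bcBondConfig ω) a i)} ≤ ε := by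
  sorry

/-! ## Proved glue -/

/-- **Shift stability from (X1) + (X2)**: the landed reduction `shiftStability_of` (p76884) fed with X1 and with X2 = the landed chain
(p81131 ∘ p84484 ∘ p90428) applied to UFRS (reshape r3). -/
theorem shiftStability : ShiftStability :=
  shiftStability_of stub_localInnerEnvelopeUI
    (shiftCouplingLocality_of_hullStability
      (hullStability_of_responseStability
        (responseStability_of_uniformForwardResponseStability stub_uniformForwardResponseStability)))

/-- **The uniform inner envelope from (X1) alone** (reshape r4: thinning glue
`uniformInnerEnvelope_of_localInnerEnvelopeUI`, `Theorems/CardyComplexConeEdgePrecompactEnvelopeFromLocal.lean`). -/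
theorem uniformInnerEnvelope : UniformInnerEnvelope :=
  uniformInnerEnvelope_of_localInnerEnvelopeUI stub_localInnerEnvelopeUI

/-- **Side result, the (P) chain (no longer an obligation): the diagonal half-plane one-arm bound
`halfArm n ≤ C n^{-1/3}`, CONDITIONAL on the Literature named fact `IkhlefPonsaingFirstPassage`** — from the landed (P1) bridge, (P2)
and (P3) (exact value at the odd width `2m+1 ∈ {n−1, n}`, its asymptotics, and the symmetry glue). -/
theorem halfArm_bound_of_IkhlefPonsaing (hIP : Literature.Probability.Percolation.IkhlefPonsaingFirstPassage) :
    ∃ C : ℝ, 0 ≤ C ∧ ∀ n : ℕ, 1 ≤ n → halfArm n ≤ C * (n : ℝ) ^ (-(1:ℝ) / 3) := by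
  obtain ⟨C, hC⟩ := stub_ipAsymptotic
  refine ⟨2 * max C 0 * (2 : ℝ) ^ ((1:ℝ) / 3), by positivity, fun n hn => ?_⟩
  obtain ⟨m, hm⟩ : ∃ m : ℕ, m = (n - 1) / 2 := ⟨_, rfl⟩
  have hL1 : 2 * m + 1 ≤ n := by omega
  have hL2 : n ≤ 2 * (2 * m + 1) := by omega
  let b : Site 2 := ![(2 * m : ℤ), 0]
  have hbsum : b 0 + b 1 = 2 * m := by simp [b]
  have h1 : halfArm n ≤ 2 * (bondPercolation (zdGraph 2) half).real (wallConn (2 * m + 1) b) :=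
    stub_halfArm_le_strip m b hbsum n hL1
  have h2 : (bondPercolation (zdGraph 2) half).real (wallConn (2 * m + 1) b) = ipRatio m :=
    stub_ipExact_of_IkhlefPonsaing hIP m b hbsum
  have h3 : ipRatio m ≤ C * (2 * (m : ℝ) + 1) ^ (-(1:ℝ) / 3) := hC m
  have hLpos : (0 : ℝ) < 2 * (m : ℝ) + 1 := by positivity
  have hnpos : (0 : ℝ) < (n : ℝ) := by exact_mod_cast hn
  have hexp : (-(1:ℝ) / 3) ≤ 0 := by norm_num
  have hle : (n : ℝ) ≤ 2 * (2 * (m : ℝ) + 1) := by exact_mod_cast hL2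
  have hcmp : (2 * (2 * (m : ℝ) + 1)) ^ (-(1:ℝ) / 3) ≤ (n : ℝ) ^ (-(1:ℝ) / 3) :=
    Real.rpow_le_rpow_of_nonpos hnpos hle hexp
  have hsplit : (2 * (2 * (m : ℝ) + 1)) ^ (-(1:ℝ) / 3) =
      (2:ℝ) ^ (-(1:ℝ) / 3) * (2 * (m : ℝ) + 1) ^ (-(1:ℝ) / 3) :=
    Real.mul_rpow (by norm_num) hLpos.le
  have htwo : (2:ℝ) ^ ((1:ℝ) / 3) * (2:ℝ) ^ (-(1:ℝ) / 3) = 1 := by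
    rw [← Real.rpow_add (by norm_num : (0:ℝ) < 2)]
    norm_num
  have hkey : (2 * (m : ℝ) + 1) ^ (-(1:ℝ) / 3) ≤ (2:ℝ) ^ ((1:ℝ) / 3) * (n : ℝ) ^ (-(1:ℝ) / 3) := by
    calc (2 * (m : ℝ) + 1) ^ (-(1:ℝ) / 3)
        = (2:ℝ) ^ ((1:ℝ) / 3) * ((2 * (2 * (m : ℝ) + 1)) ^ (-(1:ℝ) / 3)) := by
          rw [hsplit, ← mul_assoc, htwo, one_mul]
      _ ≤ (2:ℝ) ^ ((1:ℝ) / 3) * (n : ℝ) ^ (-(1:ℝ) / 3) :=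
          mul_le_mul_of_nonneg_left hcmp (by positivity)
  have hC0 : C ≤ max C 0 := le_max_left _ _
  have hmax : 0 ≤ max C 0 := le_max_right _ _
  have hr0 : 0 ≤ (2 * (m : ℝ) + 1) ^ (-(1:ℝ) / 3) := Real.rpow_nonneg hLpos.le _
  calc halfArm n ≤ 2 * ipRatio m := by rw [← h2]; exact h1
    _ ≤ 2 * (C * (2 * (m : ℝ) + 1) ^ (-(1:ℝ) / 3)) := by linarith
    _ ≤ 2 * (max C 0 * (2 * (m : ℝ) + 1) ^ (-(1:ℝ) / 3)) :=
          mul_le_mul_of_nonneg_left (mul_le_mul_of_nonneg_right hC0 hr0) (by norm_num)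
    _ ≤ 2 * (max C 0 * ((2:ℝ) ^ ((1:ℝ) / 3) * (n : ℝ) ^ (-(1:ℝ) / 3))) :=
          mul_le_mul_of_nonneg_left (mul_le_mul_of_nonneg_left hkey hmax) (by norm_num)
    _ = 2 * max C 0 * (2:ℝ) ^ ((1:ℝ) / 3) * (n : ℝ) ^ (-(1:ℝ) / 3) := by ring

/-- **Clause (i) of the crux from the uniform inner envelope, by compactness** (this is where the
interiority of `K` enters: lattice depth `≥ dist(K, Dᶜ)/δ → ∞`). -/
theorem boundClause (hU : UniformInnerEnvelope) (D : DobrushinDomain) (Λ : ℝ → DiscreteDobrushin)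
    (hΩ : ∀ δ, (Λ δ).Ω = D.carrier) (hδ : ∀ δ, (Λ δ).δ = δ)
    (hadm : ∀ᶠ δ in 𝓝[>] (0:ℝ), (Λ δ).IsZdAdmissible) (K : Set ℂ) (hK : IsCompact K)
    (hKD : K ⊆ D.carrier) :
    ∃ C : ℝ, ∀ᶠ δ in 𝓝[>] (0:ℝ), ∀ v f : Site 2, IsCorner v f → meshPoint δ v ∈ K →
      ‖cornerObs (Λ δ) δ v f‖ ≤ C * δ ^ ((1:ℝ) / 3) := by
  obtain ⟨C, hC⟩ := hU
  obtain ⟨ρ, hρ, hρD⟩ := hK.exists_thickening_subset_open D.isOpen hKD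
  refine ⟨max C 0 * (2 / ρ) ^ ((1:ℝ) / 3), ?_⟩
  have hsmall : ∀ᶠ δ in 𝓝[>] (0:ℝ), δ ∈ Ioo (0:ℝ) (ρ / 2) := Ioo_mem_nhdsGT (by positivity)
  filter_upwards [hadm, hsmall] with δ hδadm hδI
  obtain ⟨hδ0, hδρ⟩ := hδI
  intro v f hvf hvK
  -- the complement of the domain is nonempty and at distance ≥ ρ from the corner
  have hDc : D.carrierᶜ.Nonempty := by
    obtain ⟨y, hy⟩ := (Set.ne_univ_iff_exists_notMem _).1 D.toJordanDomain.carrier_ne_univ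
    exact ⟨y, hy⟩
  have hdist : ρ ≤ infDist (meshPoint δ v) D.carrierᶜ := by
    rw [le_infDist hDc]
    intro y hy
    by_contra hlt
    have hlt' : dist (meshPoint δ v) y < ρ := lt_of_not_ge hlt
    have hyb : y ∈ ball (meshPoint δ v) ρ := by
      rw [mem_ball, dist_comm]; exact hlt'
    exact hy (hρD (ball_subset_thickening hvK ρ hyb))
  -- the lattice depth R = ⌊ρ/δ⌋
  obtain ⟨R, hR⟩ : ∃ R : ℕ, R = ⌊ρ / δ⌋₊ := ⟨_, rfl⟩
  have hρδ : 2 ≤ ρ / δ := by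
    rw [le_div_iff₀ hδ0]; linarith
  have hR1 : 1 ≤ R := by
    rw [hR]
    exact Nat.floor_pos.2 (by linarith)
  have hRle : (R : ℝ) * δ ≤ ρ := by
    have : (R : ℝ) ≤ ρ / δ := by rw [hR]; exact Nat.floor_le (by positivity)
    rwa [le_div_iff₀ hδ0] at this
  have hRge : ρ / (2 * δ) ≤ (R : ℝ) := by
    have hlt : ρ / δ < (R : ℝ) + 1 := by rw [hR]; exact Nat.lt_floor_add_one _
    have hhalf : ρ / δ = 2 * (ρ / (2 * δ)) := by field_simp
    linarith
  have hx : 0 < ρ / (2 * δ) := by positivity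
  -- the envelope at depth R
  have hE : (Λ δ).δ = δ := hδ δ
  have h := hC D (Λ δ) (hΩ δ) hδadm v f hvf R hR1 (by rw [hE]; exact le_trans hRle hdist)
  rw [hE] at h
  -- R^{-1/3} ≤ (ρ/(2δ))^{-1/3} = (2/ρ)^{1/3} δ^{1/3}
  have hexp : (-(1:ℝ) / 3) ≤ 0 := by norm_num
  have hmono : (R : ℝ) ^ (-(1:ℝ) / 3) ≤ (ρ / (2 * δ)) ^ (-(1:ℝ) / 3) :=
    Real.rpow_le_rpow_of_nonpos hx hRge hexp
  have hpow : (ρ / (2 * δ)) ^ (-(1:ℝ) / 3) = (2 / ρ) ^ ((1:ℝ) / 3) * δ ^ ((1:ℝ) / 3) := by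
    calc (ρ / (2 * δ)) ^ (-(1:ℝ) / 3) = ((ρ / (2 * δ)) ^ ((1:ℝ) / 3))⁻¹ := by
            rw [show (-(1:ℝ) / 3) = -((1:ℝ) / 3) by ring, Real.rpow_neg hx.le]
      _ = ((ρ / (2 * δ))⁻¹) ^ ((1:ℝ) / 3) := (Real.inv_rpow hx.le _).symm
      _ = ((2 / ρ) * δ) ^ ((1:ℝ) / 3) := by rw [inv_div]; ring_nf
      _ = (2 / ρ) ^ ((1:ℝ) / 3) * δ ^ ((1:ℝ) / 3) := Real.mul_rpow (by positivity) hδ0.le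
  have hr0 : 0 ≤ (R : ℝ) ^ (-(1:ℝ) / 3) := Real.rpow_nonneg (by positivity) _
  calc ‖cornerObs (Λ δ) δ v f‖ ≤ C * (R : ℝ) ^ (-(1:ℝ) / 3) := h
    _ ≤ max C 0 * (R : ℝ) ^ (-(1:ℝ) / 3) := mul_le_mul_of_nonneg_right (le_max_left _ _) hr0
    _ ≤ max C 0 * (ρ / (2 * δ)) ^ (-(1:ℝ) / 3) := mul_le_mul_of_nonneg_left hmono (le_max_right _ _)
    _ = max C 0 * (2 / ρ) ^ ((1:ℝ) / 3) * δ ^ ((1:ℝ) / 3) := by rw [hpow]; ring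

/-- **Clause (ii) of the crux from translation covariance + shift stability.** -/
theorem equicontClause (hS : ShiftStability)
    (hcov : ∀ (E : DiscreteDobrushin) (δ : ℝ) (w v f : Site 2), IsCorner v f →
      cornerObs (shiftData E w) δ (v + w) (f + w) = cornerObs E δ v f)
    (D : DobrushinDomain) (Λ : ℝ → DiscreteDobrushin)
    (hΩ : ∀ δ, (Λ δ).Ω = D.carrier) (hδ : ∀ δ, (Λ δ).δ = δ)
    (hadm : ∀ᶠ δ in 𝓝[>] (0:ℝ), (Λ δ).IsZdAdmissible) (K : Set ℂ) (hK : IsCompact K)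
    (hKD : K ⊆ D.carrier) :
    ∀ ε > (0:ℝ), ∃ η > (0:ℝ), ∀ᶠ δ in 𝓝[>] (0:ℝ), ∀ v f v' f' : Site 2,
      IsCorner v f → IsCorner v' f' → f - v = f' - v' → meshPoint δ v ∈ K → meshPoint δ v' ∈ K →
      dist (meshPoint δ v) (meshPoint δ v') < η →
      ‖cornerObs (Λ δ) δ v f - cornerObs (Λ δ) δ v' f'‖ ≤ ε * δ ^ ((1:ℝ) / 3) := by
  intro ε hε
  obtain ⟨η, hη, hev⟩ := hS D Λ hΩ hδ hadm K hK hKD ε hε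
  refine ⟨η, hη, ?_⟩
  filter_upwards [hev] with δ hδev
  intro v f v' f' hvf hv'f' hclass hvK hv'K hdist
  have e1 : v + (v' - v) = v' := by abel
  have e2 : f + (v' - v) = f' := by
    calc f + (v' - v) = (f - v) + v' := by abel
      _ = (f' - v') + v' := by rw [hclass]
      _ = f' := sub_add_cancel f' v'
  have key : cornerObs (Λ δ) δ v' f' = cornerObs (shiftData (Λ δ) (-(v' - v))) δ v f := by
    have h := hcov (shiftData (Λ δ) (-(v' - v))) δ (v' - v) v f hvf
    rw [shiftData_shiftData_neg, e1, e2] at h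
    exact h
  rw [key]
  exact hδev v f (v' - v) hvf hvK (by rw [e1]; exact hv'K) (by rw [e1]; exact hdist)

/-! ## The composition (kernel-checked, no `sorry` of its own) -/

/-- **`EdgePrecompact` from the two stubs (r4).** Clause (i): (X1) `stub_localInnerEnvelopeUI` gives `UniformInnerEnvelope`
(thinning); compactness of `K` inside the open `D` gives lattice depth `≥ ρ/δ`, whence `C_K δ^{1/3}` (`boundClause`). Clause (ii):
`stub_translationCovariance` (landed) rewrites the same-class partner `(v',f') = (v+w, f+w)` as the corner `(v,f)` of the data shifted
by `−w`, and `shiftStability` ((X1) + UFRS through the landed X2 chain and `shiftStability_of`) bounds the difference. The crux's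
`E δ v f` is `cornerObs (Λ δ) δ v f` by `rfl`. -/
theorem EdgePrecompact_of : EdgePrecompact := by
  intro D Λ hΩ hδ hadm E K hK hKD
  exact ⟨boundClause uniformInnerEnvelope D Λ hΩ hδ hadm K hK hKD,
    equicontClause shiftStability stub_translationCovariance
      D Λ hΩ hδ hadm K hK hKD⟩

end

end Summit.CriticalPhenomena.CardyFormulaZ2.Cruxes.EdgePrecompact.QkzStripBoundaryArm
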